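import Literature.NumberTheory.LFunctions.JensenXiExponentialRegime
import Literature.NumberTheory.LFunctions.XiGaussModeMap
import Literature.Analysis.SpecialFunctions.LaguerreSoninTestPoints
import Literature.NumberTheory.LFunctions.JensenXiLaguerreIntegral
import HarnessLib

/-!
# All-degree hyperbolicity of the Jensen polynomials of `ξ` above an explicit exponential threshold

**Theorem (RH-FREE: kernel, unconditional, zero-free, height-free, all degrees).** For every `d ≥ 1` and every
`n ≥ 10^{2d+5}` the Jensen polynomial `J^{d,n}_γ` of the Taylor coefficients
`γ = xiTaylorCoeff` of `ξ` (Griffin–Ono–Rolen–Zagier, PNAS 116 (2019), eq. (1)) is hyperbolic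
(`jensenPoly_xiTaylorCoeff_splits_of_pow_le`); equivalently `JensenHyperbolicFrom xiTaylorCoeff d (10^{2d+5})`
for every `d` (`jensenHyperbolicFrom_xi_pow`).

GORZ 2019 Thm. 1 gives this for every `d` with an INEFFECTIVE threshold `N(d)` (tree:
`gorz_eventually_holds`); Griffin–Ono–Rolen–Thorner–Tripp–Wagner, Adv. Math. 397 (2022), Thm. 1.1
print `n > c·eᵈ` with an UNCOMPUTED absolute `c` (tree: the named fact `gorttw_thm1_1`); J. Holland,
arXiv:2608.08682 (2026), Thm. 1.1, announces the polynomial wedge `n³ log²(n+2) ≥ K d⁵` with an absolute,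
unoptimised `K`. The present threshold `10^{2d+5}` is weaker in shape but fully explicit and kernel-checked.
Statement-wise, `d ≤ 2·10¹⁷` (all shifts) is already known from verified zeros of `ζ` (Chasse 2013, via RH
to height `T`; tree: `JensenHyperbolicityRangesRS.lean`, `d ≤ 10¹⁰`); the content here is the ZERO-FREE
MECHANISM for every degree. Nothing here concerns the zeros of `ζ` (no converse is claimed; the complement
`n < 10^{2d+5}` is where the Riemann Hypothesis lives, `JensenPolyaCriterion`).

## Proof (assembled from the tree)
1. LAGUERRE SKELETON (`JensenXiLaguerreIntegral.lean`): `(√x)ⁿ J^{d,n}_γ(-x) = C ∫₀^∞ ω_{n,x}(u) w(√x u) du`,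
   `ω_{n,x} = Φ(u)uⁿe^{xu²/2}`, `w(t) = e^{-t²/2} tⁿ L_d^{(n-1/2)}(t²)` (Szegő's normal form).
2. SONIN ENVELOPES (`LaguerreSoninTestPoints.lean`): test points `t₀* < ⋯ < t_d*` in the oscillatory
   interval with `(-1)^j w(t_j*) ≥ A` and `Lip(w) ≤ A√(4d+3)`.
3. MODE MATCHING (`XiGaussModeMap.lean`): for each `j` a mode `a_j ≥ d + 1` with `a_j L(a_j) - n = (t_j*)²`
   (intermediate value theorem for `a ↦ aL(a)`, using `L ≤ 4πe^{4u} - 9`, `L ≥ 4πe^{4u} - 9.005`),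
   `x_j = (t_j*)²/a_j²`, so `√x_j · a_j = t_j*`; `x_j` increases with `j`.
4. CONCENTRATION (`XiGaussTiltedMoment.lean` + `JensenXiExponentialRegime.lean`):
   `∫(u-a_j)²ω ≤ B∫ω` with `(4d+3)x_jB < 1`, hence by `|u - a| ≤ (λ(u-a)² + λ⁻¹)/2`
   `(-1)^j ∫ ω w(√x_j u) ≥ (A/2)(1 - (4d+3)x_jB) ∫ω > 0`.
5. SIGN CHANGES: `J^{d,n}_γ` alternates in sign at `-x_d < ⋯ < -x_0 < 0`, so it has `d` real zeros
   (`exists_roots_of_alternating`, `splits_of_roots`).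

## Provenance (referee note J-n2)
The `Literature` import closure of this file (44 modules: the `LaguerreSonin*` files, `XiGaussWeight`,
`XiGaussModeMap`, `XiGaussTiltedMoment`, `JensenXiExponentialRegime`, `JensenXiLaguerreIntegral`, `JensenLaguerreSkeleton`,
`XiMoments`, `XiTiltedPotential`, `DeBruijnPhi*`, `DeBruijnNewman(Proofs)`, `DeBruijnHZeroProofs`,
`RiemannXi(Fourier)`, `BrascampLieb*`, `ConvexPotentialTails`, `JensenShiftCertificate`, `JensenHermite`,
`CoffeyCsordas2013.Derivatives`, `Hadamard*`, `PolyaFrequency*`, …) contains NO verified-zeros or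
certified-range input: in particular neither `riemannHypothesisUpTo_sixteen` nor the height-bought Turán
inequalities `xiTaylorCoeff_mul_le_sq` (`XiToeplitzCubicWedge.lean`, via Kim–Lee from RH to height `16`)
are imported. Log-concavity enters only `Φ`-side, through `DeBruijnPhiLogConcave` (Coffey–Csordas 2013:
`-(log Φ)'' = V > 16πe^{4u}`) and the envelope `4πe^{4u} - 9.005 ≤ -(log Φ)' ≤ 4πe^{4u} - 9`
(`DeBruijnPhiLogDerivEnvelope`), both zero-free. Hence: KERNEL · UNCONDITIONAL · ZERO-FREE · HEIGHT-FREE.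

## References
* [GORZPNAS2019] Griffin–Ono–Rolen–Zagier, PNAS 116 (2019) 11103–11110, Thms. 1–3, §5.
* [GriffinEtAl2022] Griffin–Ono–Rolen–Thorner–Tripp–Wagner, Adv. Math. 397 (2022) 108186, Thm. 1.1.
* [Szego1975] Szegő, *Orthogonal Polynomials*, (5.1.2), Thm. 6.31.2, §7.31.
* [BrascampLieb1976] Brascamp–Lieb, J. Funct. Anal. 22 (1976), Thm. 4.1.
* [CoffeyCsordas2013] Coffey–Csordas, Math. Comp. 82 (2013), Thm. 2.4, Prop. 2.1.
-/

noncomputable section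

open Real Set MeasureTheory Polynomial
open scoped Nat

namespace Literature.NumberTheory.LFunctions

open Literature.Analysis.SpecialFunctions (laguerreNormal laguerreTMinus laguerreTPlus laguerreTPlusSq
  laguerreTMinus_pos_lt laguerreTSq_pos_lt exists_laguerreNormal_testPoints continuous_laguerreNormal)

/-! ### The right end of the oscillatory interval -/

/-- **`t₊² ≤ n + 4d + 1 + √(2n(2d+1))`** (from `c² - 4n(n-1) = 8n(2d+1) + (4d+1)²`).
[cite: Szego1975, Thm. 6.31.2] -/
theorem laguerreTPlusSq_le (n d : ℕ) :
    laguerreTPlusSq n d ≤ n + (4 * d + 1) + Real.sqrt (2 * n * (2 * d + 1)) := by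
  unfold laguerreTPlusSq
  have hd : (0 : ℝ) ≤ d := Nat.cast_nonneg d
  have hn : (0 : ℝ) ≤ n := Nat.cast_nonneg n
  have hD : (4 * (d : ℝ) + 2 * n + 1) ^ 2 - 4 * ((n : ℝ) * ((n : ℝ) - 1)) =
      4 * (2 * n * (2 * d + 1)) + (4 * d + 1) ^ 2 := by ring
  rw [hD]
  set S := Real.sqrt (2 * n * (2 * d + 1)) with hS
  have hS0 : 0 ≤ S := Real.sqrt_nonneg _
  have hSS : S ^ 2 = 2 * n * (2 * d + 1) := Real.sq_sqrt (by positivity)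
  have hroot : Real.sqrt (4 * (2 * n * (2 * d + 1)) + (4 * d + 1) ^ 2) ≤ 2 * S + (4 * d + 1) := by
    rw [Real.sqrt_le_left (by positivity)]
    nlinarith
  linarith

/-! ### The sign of `J^{d,n}_γ(-x_j)` -/

/-- **Key estimate**: if `√x·a = t*`, `(-1)^j w(t*) ≥ A > 0`, `w` is `A·K`-Lipschitz on `(0, ∞)` and
`∫(u-a)²ω_{n,x} ≤ B ∫ω_{n,x}` with `K² x B < 1`, then `(-1)^j ∫₀^∞ ω_{n,x}(u) w(√x u) du > 0`
(via `K√x|u-a| ≤ (K²x(u-a)² + 1)/2`). [cite: GORZPNAS2019, Thm. 3] -/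
theorem sign_integral_xiGaussWeight_laguerreNormal {n d : ℕ} {x a t A K B : ℝ} (hx : 0 < x)
    (ha : 0 < a) (hta : Real.sqrt x * a = t) (hA : 0 < A) (hK : 0 ≤ K) (j : ℕ)
    (hamp : A ≤ (-1) ^ j * laguerreNormal n d t)
    (hlip : ∀ s u : ℝ, 0 < s → 0 < u →
      |laguerreNormal n d u - laguerreNormal n d s| ≤ A * K * |u - s|)
    (hB : ∫ u in Ioi 0, (u - a) ^ 2 * xiGaussWeight n x u ≤ B * ∫ u in Ioi 0, xiGaussWeight n x u)
    (hKB : K ^ 2 * x * B < 1) :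
    0 < (-1) ^ j * ∫ u in Ioi 0, xiGaussWeight n x u * laguerreNormal n d (Real.sqrt x * u) := by
  set w := laguerreNormal n d with hw
  set ω := xiGaussWeight n x with hω
  have ht : 0 < t := by rw [← hta]; exact mul_pos (Real.sqrt_pos.2 hx) ha
  have hsx : 0 < Real.sqrt x := Real.sqrt_pos.2 hx
  -- pointwise lower bound for `u > 0`
  have hpt : ∀ u, 0 < u → ω u * (A / 2 - A * K ^ 2 * x / 2 * (u - a) ^ 2) ≤ (-1) ^ j * (ω u * w (Real.sqrt x * u)) := by
    intro u hu
    have hωu : 0 < ω u := xiGaussWeight_pos n x hu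
    have hl := hlip t (Real.sqrt x * u) ht (mul_pos hsx hu)
    have e1 : Real.sqrt x * u - t = Real.sqrt x * (u - a) := by rw [← hta]; ring
    rw [e1, abs_mul, abs_of_pos hsx] at hl
    -- `(-1)^j w(√x u) ≥ A - A K √x |u - a|`
    have hsgn : |(-1 : ℝ) ^ j| = 1 := by rw [abs_pow, abs_neg, abs_one, one_pow]
    have h1 : (-1) ^ j * w t - A * K * (Real.sqrt x * |u - a|) ≤ (-1) ^ j * w (Real.sqrt x * u) := by
      have : |(-1 : ℝ) ^ j * (w (Real.sqrt x * u) - w t)| ≤ A * K * (Real.sqrt x * |u - a|) := by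
        rw [abs_mul, hsgn, one_mul]; exact hl
      have := neg_abs_le ((-1 : ℝ) ^ j * (w (Real.sqrt x * u) - w t))
      nlinarith
    -- AM–GM: `K √x |u - a| ≤ (K² x (u-a)² + 1)/2`
    have h2 : K * (Real.sqrt x * |u - a|) ≤ (K ^ 2 * x * (u - a) ^ 2 + 1) / 2 := by
      have hsq : (K * (Real.sqrt x * |u - a|)) ^ 2 = K ^ 2 * x * (u - a) ^ 2 := by
        rw [mul_pow, mul_pow, Real.sq_sqrt hx.le, sq_abs]; ring
      nlinarith [sq_nonneg (K * (Real.sqrt x * |u - a|) - 1)]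
    have h3 : A / 2 - A * K ^ 2 * x / 2 * (u - a) ^ 2 ≤ (-1) ^ j * w (Real.sqrt x * u) := by
      have := mul_le_mul_of_nonneg_left h2 hA.le
      nlinarith
    calc ω u * (A / 2 - A * K ^ 2 * x / 2 * (u - a) ^ 2)
        ≤ ω u * ((-1) ^ j * w (Real.sqrt x * u)) := mul_le_mul_of_nonneg_left h3 hωu.le
      _ = (-1) ^ j * (ω u * w (Real.sqrt x * u)) := by ring
  -- integrability
  have hZ := integral_xiGaussWeight_pos n x
  have hI0 := integrableOn_xiGaussWeight n x
  have hI2 := integrableOn_sq_sub_mul_xiGaussWeight n x a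
  have hIg : IntegrableOn (fun u => ω u * (A / 2 - A * K ^ 2 * x / 2 * (u - a) ^ 2)) (Ioi 0) := by
    have e : (fun u => ω u * (A / 2 - A * K ^ 2 * x / 2 * (u - a) ^ 2)) =
        fun u => (A / 2) * ω u + (-(A * K ^ 2 * x / 2)) * ((u - a) ^ 2 * ω u) := by
      funext u; ring
    rw [e]; exact (hI0.const_mul _).add (hI2.const_mul _)
  have hIf : IntegrableOn (fun u => (-1 : ℝ) ^ j * (ω u * w (Real.sqrt x * u))) (Ioi 0) := by
    -- `|w(√x u)| ≤ |w t| + A K √x (u + a)`, a linear-growth envelope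
    have hcont : ContinuousOn (fun u => (-1 : ℝ) ^ j * (ω u * w (Real.sqrt x * u))) (Ioi 0) :=
      (continuousOn_const.mul (((continuous_xiGaussWeight n x).mul
        ((continuous_laguerreNormal n d).comp (continuous_const.mul continuous_id))).continuousOn))
    have hdom : IntegrableOn (fun u => (|w t| + A * K * Real.sqrt x * a) * ω u +
        (A * K * Real.sqrt x) * (u ^ 1 * ω u)) (Ioi 0) :=
      (hI0.const_mul _).add ((integrableOn_pow_mul_xiGaussWeight 1 n x).const_mul _)
    refine hdom.mono' (hcont.aestronglyMeasurable measurableSet_Ioi)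
      (ae_restrict_of_forall_mem measurableSet_Ioi fun u hu => ?_)
    have hu0 : (0 : ℝ) < u := hu
    have hωu : 0 < ω u := xiGaussWeight_pos n x hu0
    have hl := hlip t (Real.sqrt x * u) ht (mul_pos hsx hu0)
    have e1 : Real.sqrt x * u - t = Real.sqrt x * (u - a) := by rw [← hta]; ring
    rw [e1, abs_mul, abs_of_pos hsx] at hl
    have hua : |u - a| ≤ u + a := by
      rw [abs_le]; constructor <;> linarith
    have hwb : |w (Real.sqrt x * u)| ≤ |w t| + A * K * Real.sqrt x * (u + a) := by
      have := abs_sub_abs_le_abs_sub (w (Real.sqrt x * u)) (w t)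
      have h2 : A * K * (Real.sqrt x * |u - a|) ≤ A * K * Real.sqrt x * (u + a) := by
        have := mul_le_mul_of_nonneg_left hua (by positivity : 0 ≤ A * K * Real.sqrt x)
        linarith [this]
      linarith
    rw [Real.norm_eq_abs, abs_mul, abs_pow, abs_neg, abs_one, one_pow, one_mul, abs_mul,
      abs_of_pos hωu, pow_one]
    calc ω u * |w (Real.sqrt x * u)| ≤ ω u * (|w t| + A * K * Real.sqrt x * (u + a)) :=
          mul_le_mul_of_nonneg_left hwb hωu.le
      _ = (|w t| + A * K * Real.sqrt x * a) * ω u + A * K * Real.sqrt x * (u * ω u) := by ring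
  -- integrate the pointwise bound
  have hmono : ∫ u in Ioi 0, ω u * (A / 2 - A * K ^ 2 * x / 2 * (u - a) ^ 2) ≤
      ∫ u in Ioi 0, (-1 : ℝ) ^ j * (ω u * w (Real.sqrt x * u)) :=
    setIntegral_mono_on hIg hIf measurableSet_Ioi fun u hu => hpt u hu
  have hsplit : ∫ u in Ioi 0, ω u * (A / 2 - A * K ^ 2 * x / 2 * (u - a) ^ 2) =
      (A / 2) * (∫ u in Ioi 0, ω u) - (A * K ^ 2 * x / 2) * ∫ u in Ioi 0, (u - a) ^ 2 * ω u := by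
    have e : (fun u => ω u * (A / 2 - A * K ^ 2 * x / 2 * (u - a) ^ 2)) =
        fun u => (A / 2) * ω u - (A * K ^ 2 * x / 2) * ((u - a) ^ 2 * ω u) := by
      funext u; ring
    rw [e, integral_sub (hI0.const_mul _) (hI2.const_mul _), integral_const_mul, integral_const_mul]
  rw [integral_const_mul] at hmono
  rw [hsplit] at hmono
  -- `(A/2) Z - (A K² x/2) V₂ ≥ (A/2) Z (1 - K² x B) > 0`
  have hV : (A * K ^ 2 * x / 2) * ∫ u in Ioi 0, (u - a) ^ 2 * ω u ≤
      (A * K ^ 2 * x / 2) * (B * ∫ u in Ioi 0, ω u) :=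
    mul_le_mul_of_nonneg_left hB (by positivity)
  have hpos : 0 < (A / 2) * (∫ u in Ioi 0, ω u) - (A * K ^ 2 * x / 2) * (B * ∫ u in Ioi 0, ω u) := by
    have e : (A / 2) * (∫ u in Ioi 0, ω u) - (A * K ^ 2 * x / 2) * (B * ∫ u in Ioi 0, ω u) =
        (A / 2) * (∫ u in Ioi 0, ω u) * (1 - K ^ 2 * x * B) := by ring
    rw [e]
    exact mul_pos (mul_pos (by linarith) hZ) (by linarith)
  linarith

/-! ### The main theorem -/

/-- **All-degree hyperbolicity above an explicit exponential threshold (RH-FREE).** For every `d ≥ 1` and every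
`n ≥ 10^{2d+5}`, the Jensen polynomial `J^{d,n}_γ` of the Taylor coefficients `γ = xiTaylorCoeff` of
`ξ` is hyperbolic. Zero-free, height-free: no input on the zeros of `ζ`. (GORZ Thm. 1 made explicit;
cf. Griffin–Ono–Rolen–Thorner–Tripp–Wagner Thm. 1.1, `n > c eᵈ` with `c` uncomputed.)
[cite: GORZPNAS2019, Thm. 1] -/
theorem jensenPoly_xiTaylorCoeff_splits_of_pow_le {d n : ℕ} (hd : 1 ≤ d) (hn : 10 ^ (2 * d + 5) ≤ n) :
    (jensenPoly xiTaylorCoeff d n).Splits := by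
  have hn' : (10 : ℝ) ^ (2 * d + 5) ≤ n := by exact_mod_cast hn
  obtain ⟨hs300, -, hn3, hn7⟩ := xiGauss_regime_size hd hn'
  have hnpos : (0 : ℝ) < n := lt_of_lt_of_le (by norm_num) hn7
  have hn2 : 2 ≤ n := by
    have : (2 : ℝ) ≤ n := le_trans (by norm_num) hn7
    exact_mod_cast this
  -- Step 2: test points of the normal form
  obtain ⟨ts, hts, htsmem, A, hA, hamp, hlip⟩ := exists_laguerreNormal_testPoints n d hn2 hd
  set K := Real.sqrt (4 * d + 3) with hK
  have hK0 : 0 ≤ K := Real.sqrt_nonneg _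
  have hK2 : K ^ 2 = 4 * d + 3 := Real.sq_sqrt (by positivity)
  have hts0 : ∀ j, 0 < ts j := fun j => (laguerreTMinus_pos_lt n d hn2).1.trans (htsmem j).1
  -- bounds for `y_j = (ts j)²`
  have hyE : ∀ j, ts j ^ 2 ≤ n + (4 * d + 1) + Real.sqrt (2 * n * (2 * d + 1)) := by
    intro j
    have h1 : ts j ^ 2 < laguerreTPlus n d ^ 2 :=
      pow_lt_pow_left₀ (htsmem j).2 (hts0 j).le two_ne_zero
    have h2 : laguerreTPlus n d ^ 2 = laguerreTPlusSq n d :=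
      Real.sq_sqrt ((laguerreTSq_pos_lt n d hn2).1.trans (laguerreTSq_pos_lt n d hn2).2).le
    rw [h2] at h1
    exact h1.le.trans (laguerreTPlusSq_le n d)
  have hSn : Real.sqrt (2 * n * (2 * d + 1)) ≤ n / 2 := by
    rw [Real.sqrt_le_left (by positivity)]
    have hd' : (1 : ℝ) ≤ d := by exact_mod_cast hd
    nlinarith
  have hy2n : ∀ j, ts j ^ 2 ≤ 2 * n := fun j => by
    have := hyE j
    have hd' : (1 : ℝ) ≤ d := by exact_mod_cast hd
    nlinarith
  -- Step 3: modes
  choose a ha_lo ha_hi ha_eq using fun j : Fin (d + 1) =>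
    exists_xiGauss_mode hd hn' (pow_pos (hts0 j) 2) (hy2n j)
  have ha1 : ∀ j, (1 : ℝ) ≤ a j := fun j => by
    have := ha_lo j; have : (0 : ℝ) ≤ d := Nat.cast_nonneg d; linarith
  have ha0 : ∀ j, 0 < a j := fun j => lt_of_lt_of_le one_pos (ha1 j)
  set x : Fin (d + 1) → ℝ := fun j => xiGaussX n (a j) with hxdef
  have hxy : ∀ j, x j = ts j ^ 2 / a j ^ 2 := fun j => by
    show xiGaussX n (a j) = _; rw [xiGaussX, ha_eq]
  have hx0 : ∀ j, 0 < x j := fun j => by rw [hxy]; exact div_pos (pow_pos (hts0 j) 2) (pow_pos (ha0 j) 2)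
  have hsxa : ∀ j, Real.sqrt (x j) * a j = ts j := fun j => by
    rw [hxy, Real.sqrt_div (sq_nonneg _), Real.sqrt_sq (hts0 j).le, Real.sqrt_sq (ha0 j).le]
    exact div_mul_cancel₀ _ (ha0 j).ne'
  -- `x` is strictly increasing
  have hxmono : StrictMono x := by
    intro i j hij
    have hty : ts i ^ 2 < ts j ^ 2 := pow_lt_pow_left₀ (hts hij) (hts0 i).le two_ne_zero
    have haij : a i < a j := by
      by_contra h
      have h' : a j ≤ a i := not_lt.1 h
      have := xiGaussY_mono n (ha0 j) h'
      rw [ha_eq, ha_eq] at this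
      linarith
    exact xiGaussX_strictMonoOn n (ha1 i) (ha1 j) haij
  -- Step 4: the sign at `-x j`
  have hsign : ∀ j : Fin (d + 1), 0 < (-1) ^ (j : ℕ) * (jensenPoly xiTaylorCoeff d n).eval (-(x j)) := by
    intro j
    obtain ⟨hC, hρ, hmain⟩ := xiGauss_regime hd hn' (ha_lo j) (ha_hi j) (pow_pos (hts0 j) 2)
      (hyE j) (ha_eq j)
    have hy0 : 0 ≤ xiGaussY n (a j) := by rw [ha_eq]; exact (pow_pos (hts0 j) 2).le
    have ha32 : (3 : ℝ) / 2 ≤ a j := by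
      have h1 := ha_lo j
      have h2 : (1 : ℝ) ≤ d := by exact_mod_cast hd
      linarith
    have hB := xiGauss_sq_sub_integral_le n ha32 (by norm_num) (by norm_num) hy0 hC hρ
    refine sign_eval_jensenPoly_xiTaylorCoeff_neg d n (hx0 j) j ?_
    refine sign_integral_xiGaussWeight_laguerreNormal (hx0 j) (ha0 j) (hsxa j) hA hK0 j (hamp j)
      (fun s u hs hu => hlip s u hs hu) hB ?_
    rw [hK2]; exact hmain
  -- Step 5: alternating signs at `-x_d < ⋯ < -x_0`
  set P := jensenPoly xiTaylorCoeff d n with hP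
  set u : Fin (d + 1) → ℝ := fun i => -(x (Fin.rev i)) with hu
  have humono : StrictMono u := fun i j hij => by
    show -(x (Fin.rev i)) < -(x (Fin.rev j))
    exact neg_lt_neg (hxmono (Fin.rev_lt_rev.2 hij))
  have halt : ∀ i : Fin d, P.eval (u i.castSucc) * P.eval (u i.succ) < 0 := by
    intro i
    have h1 := hsign (Fin.rev i.castSucc)
    have h2 := hsign (Fin.rev i.succ)
    have e1 : ((Fin.rev i.castSucc : Fin (d + 1)) : ℕ) = ((Fin.rev i.succ : Fin (d + 1)) : ℕ) + 1 := by
      simp [Fin.val_rev]; omega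
    rw [e1, pow_succ] at h1
    have h12 := mul_pos h1 h2
    have hsq : ((-1 : ℝ) ^ ((Fin.rev i.succ : Fin (d + 1)) : ℕ)) ^ 2 = 1 := by
      rw [← pow_mul, mul_comm, pow_mul]; simp
    show P.eval (-(x (Fin.rev i.castSucc))) * P.eval (-(x (Fin.rev i.succ))) < 0
    nlinarith
  obtain ⟨t, htmono, -, hroot⟩ := exists_roots_of_alternating P u humono halt
  have hP0 : P ≠ 0 := by
    intro h0
    have := hsign 0
    rw [h0] at this
    simp at this
  exact (splits_of_roots hP0 (Literature.Analysis.Complex.PolyaSchur.natDegree_jensenPoly_le _ d n)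
    t htmono.injective hroot).1

/-- **`JensenHyperbolicFrom xiTaylorCoeff d (10^{2d+5})` for every degree `d`** (`d = 0`: the constant
`γ(n) ≠ 0`). [cite: GORZPNAS2019, Thm. 1] -/
theorem jensenHyperbolicFrom_xi_pow (d : ℕ) : JensenHyperbolicFrom xiTaylorCoeff d (10 ^ (2 * d + 5)) := by
  intro n hn
  rcases Nat.eq_zero_or_pos d with rfl | hd
  · have h0 : jensenPoly xiTaylorCoeff 0 n = C (xiTaylorCoeff n) := by simp [jensenPoly]
    rw [h0]; exact Splits.C _
  · exact jensenPoly_xiTaylorCoeff_splits_of_pow_le hd hn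

/-- The same threshold stated with an existential-free `N(d) = 10^{2d+5}`: GORZ Theorem 1 for `ξ` with an
explicit shift, for all degrees at once. [cite: GORZPNAS2019, Thm. 1] -/
theorem jensenPoly_xiTaylorCoeff_splits_all_degrees :
    ∀ d n : ℕ, 10 ^ (2 * d + 5) ≤ n → (jensenPoly xiTaylorCoeff d n).Splits :=
  fun d n hn => jensenHyperbolicFrom_xi_pow d n hn

/-- The cell's typed PROOF-OF-DATA target **P0′** (`ExplicitGORTTWPow10` of the rh-jensen theory seat), in
its literal shape `∀ d n, 1 ≤ d → 10^(2d+5) ≤ n → J^{d,n}_γ hyperbolic` (RH-FREE). [cite: GORZPNAS2019, Thm. 1] -/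
theorem explicitGORTTW_pow_ten :
    ∀ d n : ℕ, 1 ≤ d → 10 ^ (2 * d + 5) ≤ n → (jensenPoly xiTaylorCoeff d n).Splits :=
  fun _ _ hd hn => jensenPoly_xiTaylorCoeff_splits_of_pow_le hd hn

end Literature.NumberTheory.LFunctions
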